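import Summits.HubbardSuperconductivity.HubbardSuperconductivity.Theorems.AnisotropyChordTransferFibre3FinX3Eval

/-!
# Route `AnisotropyChord` / H0 rotor rung: FIN per-`L` GM₃ (X4), `L = 25` — rows `N₁` / D / side-condition cell facts, part `p25`

Kernel facts (`decide +kernel`) for cert cells 69, 70 of the per-`L` grid of `L = 25`: `xbnCellAny2` (row `N₁` on XB2 point wedges recomputed in the kernel, exporting the literal brackets `nt ⊇ T⁺ − 3λ₂` and `tb ⊇ T⁺·D`), `xdCellAnyN0` (row D, reads `nt`), `sdCellAnyZN` (side condition, reads `nt`); evaluators `…FinX3Eval`; constants from the compiled design probe (x3probe/x3plan, margins c ×0.985, b ×1.03, aD ×1.03); assembled in `…FinX3GM3TwentyFive`.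
Prover seat `hubbard-h0-rotor-p3` g8; helper for piece A = stmt-HubbardSuperconductivity-23918 of rung 19089 (`--supports`, helper class).
WHAT THIS IS NOT: nothing here proves superconductivity in the Hubbard model (rotor TARGET as worded stays FALSE, g15 verdict); kernel facts for the FIN certificate of ONE conditional reduction.  Tree imports only; zero data; standard axioms.
-/

set_option linter.dupNamespace false
set_option autoImplicit false

namespace Summit.HubbardSuperconductivity.HubbardSuperconductivity.Theorems.AnisotropyChord.Transfer.Fibre3

namespace FinXD

open FinXB FinCell Hole2

set_option maxHeartbeats 4000000 in
/-- row `N₁` of cell 69 of `L = 25` (`c = 3/5`), exporting `nt`, `tb`. [folklore] -/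
theorem xn25_69 : xbnCellAny2 25 (49/50 : ℚ) 470632534745285 482398348113918 (3/5 : ℚ) ((-2972306986544 : ℤ), (4614364692416 : ℤ)) ((1408916679710223 : ℤ), (1451818026573258 : ℤ)) = true := by decide +kernel

set_option maxHeartbeats 4000000 in
/-- row D of cell 69 of `L = 25` (`aD = 81/1000`). [folklore] -/
theorem xd25_69 : xdCellAnyN0 25 (49/50 : ℚ) 470632534745285 482398348113918 (81/1000 : ℚ) ((-2972306986544 : ℤ), (4614364692416 : ℤ)) = true := by decide +kernel

set_option maxHeartbeats 4000000 in
/-- side condition of cell 69 of `L = 25` (`c, b = 61/100, aD`). [folklore] -/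
theorem sd25_69 : sdCellAnyZN 25 (49/50 : ℚ) 100 470632534745285 482398348113918 ((3/5 : ℚ), (61 : ℕ), (81/1000 : ℚ)) ((-2972306986544 : ℤ), (4614364692416 : ℤ)) = true := by decide +kernel

set_option maxHeartbeats 4000000 in
/-- row `N₁` of cell 70 of `L = 25` (`c = 3/5`), exporting `nt`, `tb`. [folklore] -/
theorem xn25_70 : xbnCellAny2 25 (49/50 : ℚ) 482398348113918 494458306816766 (3/5 : ℚ) ((-2904363183609 : ℤ), (4667181233790 : ℤ)) ((1444281848180580 : ℤ), (1488050934661653 : ℤ)) = true := by decide +kernel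

set_option maxHeartbeats 4000000 in
/-- row D of cell 70 of `L = 25` (`aD = 81/1000`). [folklore] -/
theorem xd25_70 : xdCellAnyN0 25 (49/50 : ℚ) 482398348113918 494458306816766 (81/1000 : ℚ) ((-2904363183609 : ℤ), (4667181233790 : ℤ)) = true := by decide +kernel

set_option maxHeartbeats 4000000 in
/-- side condition of cell 70 of `L = 25` (`c, b = 61/100, aD`). [folklore] -/
theorem sd25_70 : sdCellAnyZN 25 (49/50 : ℚ) 100 482398348113918 494458306816766 ((3/5 : ℚ), (61 : ℕ), (81/1000 : ℚ)) ((-2904363183609 : ℤ), (4667181233790 : ℤ)) = true := by decide +kernel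

end FinXD

end Summit.HubbardSuperconductivity.HubbardSuperconductivity.Theorems.AnisotropyChord.Transfer.Fibre3
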